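import Summits.AtomisticToContinuum.Crystallization.Theorems.ChartedZeroExcessLayeredLatticeLiouvilleXI

/-!
# Zero-excess layered lattice Liouville — part XJ (lens-2 g59, node «SBGlueC2», third part): (E2) DECAY, (E3) MODE SIZE, (E4) RE-CHART — the energy algebra

Critic rows 1051/1119 (ORDER OF RECORD for `stmt-AtomisticToContinuum-26636`): leaf (2) `SubWindowBudgetGlueBPG` via SBGlueA–D.  Memo NODE-g59a §2: after the
comparison estimate (E1, part XI) one step of the index-side recursion continues with (E2) modal decay of the comparison field `V` ((LD)(i) `ModalDecayAt`),
(E3) the size `m` of the subtracted mode `M` ((LD)(ii) `ModeRigidAt`: `m²·#B ≤ C·E(M)(B)`), and (E4) the re-charting by (RC) `EquilChartStrainP`, after which the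
new pulled-back displacement is `φ' = (φ − M) − (lsite' − lsite − M)` with the last field `(C_R m² + ε m)`-index-Lipschitz.  This file PROVES the energy algebra of
these three moves over the real objects (no clause is consumed yet — each enters as the instance hypothesis of its literal shape; part XK instantiates):

* XJ.1 INDEX-ENERGY ALGEBRA on finite windows: `E(φ + ψ) ≤ 2E(φ) + 2E(ψ)`, `E(−φ) = E(φ)`, `E(φ − ψ) ≤ 2E(φ) + 2E(ψ)`, and `E(A)(Q) ≤ 27·L²·#Q` for an
  `L`-index-Lipschitz `A` (VG `card_unitPairs_le`).
* XJ.2 ★ (E2)+(E3) `mode_of_decay`: `ModalDecayAt C ϱ t n₁` + `ModeRigidAt C ϱ n₁` at a truncated-harmonic `V` on `idxBall X₀ n` (`n ≥ n₁`) give a mode `M`, its SIZE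
  `m = √(C·E(M)(B_r)/#B_r) ≥ 0` on any ball `B_r`, `r ≥ n₁` (`IsIdxLipschitz m M`, `m²·#B_r ≤ C·E(M)(B_r)`) and the decay `E(V − M)(B_{tn})·#B_n ≤ C t²·E(V)(B_n)·#B_{tn}`;
  ★ `excess_decay_step` / ★ `mode_size_step`: with the comparison error `E(φ − V) ≤ W` (the (E1) quantity) and `K = C t²·#B_{tn}/#B_n`,
  `E(φ − M)(B_{tn}) ≤ 2W + 2K·(2E(φ)(B_n) + 2W)` and `m²·#B_{tn} ≤ C(2 + 2K)·(2E(φ)(B_n) + 2W)` — the next excess and the mode size in terms of this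
  excess and the comparison error.
* XJ.3 ★ (E4) `idxEnergy_pullDisp_transReg_le`: for the re-charted registration `Ψ' = transReg Ψ a b w a' b' w'` (XD.3) and ANY field `M`,
  `E(pullDisp S Ψ' a' b' w')(Q) ≤ 2E(pullDisp S Ψ a b w − M)(Q) + 54·L²·#Q` whenever `lsite' − lsite − M` is `L`-index-Lipschitz — with (RC)'s output
  `L = C_R m² + ε m` this is the excess of the NEXT iterate.
-/

noncomputable section

open scoped BigOperators InnerProductSpace RealInnerProductSpace
open Set Function Metric
open Summit.AtomisticToContinuum.Crystallization.Theorems.ChartedPlanarOrderRigidityDoor (E3 IsClean)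
open Summit.AtomisticToContinuum.Crystallization.Theorems.ChartedPlanarOrderDensityDichotomy (μS IsSep nK)
open Summit.AtomisticToContinuum.Crystallization.Theorems.ChartedPlanarOrderDoorLayered (Layered)

namespace Summit.AtomisticToContinuum.Crystallization.Theorems.ChartedZeroExcessLayeredLatticeLiouville

/-! ### XJ.1  Index-energy algebra on finite windows -/

/-- the parallelogram bound for index energies. [this file, g59] -/
theorem idxEnergy_add_le (φ ψ : Cell 2 → ℤ → E3) (Q : Finset (Cell 2 × ℤ)) :
    idxEnergy (φ + ψ) ↑Q ≤ 2 * idxEnergy φ ↑Q + 2 * idxEnergy ψ ↑Q := by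
  rw [idxEnergy_coe_finset, idxEnergy_coe_finset, idxEnergy_coe_finset, Finset.mul_sum, Finset.mul_sum, ← Finset.sum_add_distrib]
  refine Finset.sum_le_sum fun x _ => ?_
  simp only [Pi.add_apply]
  have e : φ x.2.1 x.2.2 + ψ x.2.1 x.2.2 - (φ x.1.1 x.1.2 + ψ x.1.1 x.1.2) =
      (φ x.2.1 x.2.2 - φ x.1.1 x.1.2) + (ψ x.2.1 x.2.2 - ψ x.1.1 x.1.2) := by abel
  rw [e]
  exact norm_add_sq_le_two _ _

/-- index energies are even. [formal bookkeeping] -/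
theorem idxEnergy_neg (φ : Cell 2 → ℤ → E3) (B : Set (Cell 2 × ℤ)) : idxEnergy (-φ) B = idxEnergy φ B := by
  unfold idxEnergy
  refine finsum_mem_congr rfl fun x _ => ?_
  simp only [Pi.neg_apply]
  rw [← norm_neg]
  congr 1
  abel

/-- the parallelogram bound for differences. [this file, g59] -/
theorem idxEnergy_sub_le (φ ψ : Cell 2 → ℤ → E3) (Q : Finset (Cell 2 × ℤ)) :
    idxEnergy (φ - ψ) ↑Q ≤ 2 * idxEnergy φ ↑Q + 2 * idxEnergy ψ ↑Q := by
  rw [sub_eq_add_neg]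
  have h := idxEnergy_add_le φ (-ψ) Q
  rwa [idxEnergy_neg] at h

/-- ★ an `L`-index-Lipschitz field has energy `≤ 27·L²·#Q` on a window `Q`. [this file, g59] -/
theorem idxEnergy_le_of_lipschitz {L : ℝ} {A : Cell 2 → ℤ → E3} (hA : ∀ X Y : Cell 2 × ℤ, ‖A Y.1 Y.2 - A X.1 X.2‖ ≤ L * dist X Y)
    (Q : Finset (Cell 2 × ℤ)) : idxEnergy A ↑Q ≤ 27 * L ^ 2 * Q.card := by
  have hL0 : 0 ≤ L := by
    have h1 := hA (0, 0) (0, 1)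
    have hd : (0 : ℝ) < dist ((0, 0) : Cell 2 × ℤ) (0, 1) := dist_pos.2 (by simp)
    nlinarith [norm_nonneg (A ((0, 1) : Cell 2 × ℤ).1 ((0, 1) : Cell 2 × ℤ).2 - A ((0, 0) : Cell 2 × ℤ).1 ((0, 0) : Cell 2 × ℤ).2)]
  have hcard : (((Q ×ˢ Q).filter fun x : (Cell 2 × ℤ) × (Cell 2 × ℤ) => dist x.1 x.2 ≤ 1).card : ℝ) ≤ 27 * Q.card := by
    exact_mod_cast card_unitPairs_le Q
  rw [idxEnergy_coe_finset]
  calc ∑ x ∈ (Q ×ˢ Q).filter (fun x => dist x.1 x.2 ≤ 1), ‖A x.2.1 x.2.2 - A x.1.1 x.1.2‖ ^ 2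
      ≤ ∑ x ∈ (Q ×ˢ Q).filter (fun x => dist x.1 x.2 ≤ 1), L ^ 2 := by
        refine Finset.sum_le_sum fun x hx => ?_
        have hd : dist x.1 x.2 ≤ 1 := (Finset.mem_filter.1 hx).2
        have h1 : ‖A x.2.1 x.2.2 - A x.1.1 x.1.2‖ ≤ L := (hA x.1 x.2).trans (by nlinarith)
        exact pow_le_pow_left₀ (norm_nonneg _) h1 2
    _ ≤ 27 * L ^ 2 * Q.card := by
        rw [Finset.sum_const, nsmul_eq_mul]
        nlinarith [sq_nonneg L]

/-! ### XJ.2  (E2) modal decay and (E3) the size of the mode -/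

/-- index balls are finite. [formal bookkeeping] -/
theorem finite_idxBall (x₀ : Cell 2 × ℤ) (n : ℝ) : (idxBall x₀ n).Finite := by
  rw [← coe_idxBallF]
  exact (idxBallF x₀ n).finite_toSet

section Decay

variable {a b : E3} {w : ℤ → E3}

/-- ★ **(E2)+(E3) THE MODE AND ITS SIZE**: `ModalDecayAt` + `ModeRigidAt` at a truncated-harmonic `V` on `idxBall X₀ n` (`n ≥ n₁`) give a mode `M`, its size
`m ≥ 0` measured on ANY ball `idxBall X₀ r` with `r ≥ n₁` (`IsIdxLipschitz m M`, `m²·#B_r ≤ C·E(M)(B_r)`), and the decay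
`E(V − M)(B_{tn})·#B_n ≤ C t²·E(V)(B_n)·#B_{tn}`. [this file, g59] -/
theorem mode_of_decay {C ϱ t n₁ n r : ℝ} (hMD : ModalDecayAt C ϱ t n₁ a b w) (hMR : ModeRigidAt C ϱ n₁ a b w) (hC : 0 ≤ C) (hn₁ : n₁ ≤ n)
    (hr₁ : n₁ ≤ r) (hr : 0 ≤ r) (X₀ : Cell 2 × ℤ) {V : Cell 2 → ℤ → E3} (hV : IsTruncHarmonicZ ϱ a b w V (idxBall X₀ n)) :
    ∃ M : Cell 2 → ℤ → E3, ∃ m : ℝ, IsTruncMode ϱ a b w M ∧ 0 ≤ m ∧ IsIdxLipschitz m M ∧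
      m ^ 2 * ((idxBall X₀ r).ncard : ℝ) ≤ C * idxEnergy M (idxBall X₀ r) ∧
        idxEnergy (V - M) (idxBall X₀ (t * n)) * ((idxBall X₀ n).ncard : ℝ) ≤
          C * t ^ 2 * idxEnergy V (idxBall X₀ n) * ((idxBall X₀ (t * n)).ncard : ℝ) := by
  obtain ⟨M, hM, hdec⟩ := hMD V X₀ n hn₁ hV
  have hN : (0 : ℝ) < ((idxBall X₀ r).ncard : ℝ) := ncard_idxBall_pos X₀ hr
  have hE : 0 ≤ idxEnergy M (idxBall X₀ r) := idxEnergy_nonneg _ _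
  set m : ℝ := Real.sqrt (C * idxEnergy M (idxBall X₀ r) / ((idxBall X₀ r).ncard : ℝ)) with hm
  have hm2 : m ^ 2 = C * idxEnergy M (idxBall X₀ r) / ((idxBall X₀ r).ncard : ℝ) := Real.sq_sqrt (by positivity)
  refine ⟨M, m, hM, Real.sqrt_nonneg _, fun X Y => ?_, ?_, hdec⟩
  · have h := hMR M hM X₀ r hr₁ X Y
    have h2 : ‖M Y.1 Y.2 - M X.1 X.2‖ ^ 2 ≤ (m * dist X Y) ^ 2 := by
      rw [mul_pow, hm2, div_mul_eq_mul_div, le_div_iff₀ hN]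
      linarith
    calc ‖M Y.1 Y.2 - M X.1 X.2‖ = Real.sqrt (‖M Y.1 Y.2 - M X.1 X.2‖ ^ 2) := (Real.sqrt_sq (norm_nonneg _)).symm
      _ ≤ Real.sqrt ((m * dist X Y) ^ 2) := Real.sqrt_le_sqrt h2
      _ = m * dist X Y := Real.sqrt_sq (mul_nonneg (Real.sqrt_nonneg _) dist_nonneg)
  · rw [hm2, div_mul_cancel₀ _ hN.ne']

/-- the two parallelogram splits used below: `E(φ − M) ≤ 2E(φ − V) + 2E(V − M)` and `E(V) ≤ 2E(φ) + 2E(φ − V)` (and the same for `M` against `V`).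
[formal bookkeeping] -/
theorem excess_split (φ V M : Cell 2 → ℤ → E3) (X₀ : Cell 2 × ℤ) (r n : ℝ) :
    idxEnergy (φ - M) (idxBall X₀ r) ≤ 2 * idxEnergy (φ - V) (idxBall X₀ r) + 2 * idxEnergy (V - M) (idxBall X₀ r) ∧
      idxEnergy V (idxBall X₀ n) ≤ 2 * idxEnergy φ (idxBall X₀ n) + 2 * idxEnergy (φ - V) (idxBall X₀ n) := by
  refine ⟨?_, ?_⟩
  · have e : φ - M = (φ - V) + (V - M) := by abel
    rw [e, ← coe_idxBallF]
    exact idxEnergy_add_le _ _ _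
  · have e : V = φ - (φ - V) := by abel
    rw [← coe_idxBallF]
    conv_lhs => rw [e]
    exact idxEnergy_sub_le _ _ _

/-- ★ **(E2) THE EXCESS AT THE NEXT SCALE**: the decay inequality of `mode_of_decay` for the comparison field `V` of `φ`, with the comparison error
`E(φ − V) ≤ W` on both balls (W = the (E1)-controlled quantity `E(φ − V)(nbhd1 P)`), gives
`E(φ − M)(B_{tn}) ≤ 2W + 2K·(2E(φ)(B_n) + 2W)`, `K = C t²·#B_{tn}/#B_n`. [this file, g59] -/
theorem excess_decay_step {C t n W : ℝ} (hC : 0 ≤ C) (hn : 0 ≤ n) (φ V M : Cell 2 → ℤ → E3) (X₀ : Cell 2 × ℤ)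
    (hdec : idxEnergy (V - M) (idxBall X₀ (t * n)) * ((idxBall X₀ n).ncard : ℝ) ≤
      C * t ^ 2 * idxEnergy V (idxBall X₀ n) * ((idxBall X₀ (t * n)).ncard : ℝ))
    (hWt : idxEnergy (φ - V) (idxBall X₀ (t * n)) ≤ W) (hWn : idxEnergy (φ - V) (idxBall X₀ n) ≤ W) :
    idxEnergy (φ - M) (idxBall X₀ (t * n)) ≤
      2 * W + 2 * (C * t ^ 2 * ((idxBall X₀ (t * n)).ncard : ℝ) / ((idxBall X₀ n).ncard : ℝ)) * (2 * idxEnergy φ (idxBall X₀ n) + 2 * W) := by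
  have hN : (0 : ℝ) < ((idxBall X₀ n).ncard : ℝ) := ncard_idxBall_pos X₀ hn
  obtain ⟨h1, h2⟩ := excess_split φ V M X₀ (t * n) n
  set K : ℝ := C * t ^ 2 * ((idxBall X₀ (t * n)).ncard : ℝ) / ((idxBall X₀ n).ncard : ℝ) with hK
  have hK0 : 0 ≤ K := by rw [hK]; positivity
  have h3 : idxEnergy (V - M) (idxBall X₀ (t * n)) ≤ K * idxEnergy V (idxBall X₀ n) := by
    rw [hK, div_mul_eq_mul_div, le_div_iff₀ hN]
    calc idxEnergy (V - M) (idxBall X₀ (t * n)) * ((idxBall X₀ n).ncard : ℝ)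
        ≤ C * t ^ 2 * idxEnergy V (idxBall X₀ n) * ((idxBall X₀ (t * n)).ncard : ℝ) := hdec
      _ = C * t ^ 2 * ((idxBall X₀ (t * n)).ncard : ℝ) * idxEnergy V (idxBall X₀ n) := by ring
  have h4 : K * idxEnergy V (idxBall X₀ n) ≤ K * (2 * idxEnergy φ (idxBall X₀ n) + 2 * W) :=
    mul_le_mul_of_nonneg_left (by linarith) hK0
  linarith

/-- ★ **(E3) THE SIZE OF THE MODE** in the same currency: with the size measured on `B_{tn}` (`t ≤ 1`),
`m²·#B_{tn} ≤ C·(2 + 2K)·(2E(φ)(B_n) + 2W)`. [this file, g59] -/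
theorem mode_size_step {C t n m W : ℝ} (hC : 0 ≤ C) (ht1 : t ≤ 1) (hn : 0 ≤ n) (φ V M : Cell 2 → ℤ → E3) (X₀ : Cell 2 × ℤ)
    (hm : m ^ 2 * ((idxBall X₀ (t * n)).ncard : ℝ) ≤ C * idxEnergy M (idxBall X₀ (t * n)))
    (hdec : idxEnergy (V - M) (idxBall X₀ (t * n)) * ((idxBall X₀ n).ncard : ℝ) ≤
      C * t ^ 2 * idxEnergy V (idxBall X₀ n) * ((idxBall X₀ (t * n)).ncard : ℝ))
    (hWn : idxEnergy (φ - V) (idxBall X₀ n) ≤ W) :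
    m ^ 2 * ((idxBall X₀ (t * n)).ncard : ℝ) ≤
      C * (2 + 2 * (C * t ^ 2 * ((idxBall X₀ (t * n)).ncard : ℝ) / ((idxBall X₀ n).ncard : ℝ))) * (2 * idxEnergy φ (idxBall X₀ n) + 2 * W) := by
  have hN : (0 : ℝ) < ((idxBall X₀ n).ncard : ℝ) := ncard_idxBall_pos X₀ hn
  have htn : t * n ≤ n := by nlinarith
  obtain ⟨-, h2⟩ := excess_split φ V M X₀ (t * n) n
  obtain ⟨-, h2'⟩ := excess_split V M M X₀ (t * n) (t * n)
  have h5 : idxEnergy V (idxBall X₀ (t * n)) ≤ idxEnergy V (idxBall X₀ n) := idxEnergy_mono_set (idxBall_mono X₀ htn) (finite_idxBall X₀ n) V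
  obtain ⟨-, h6⟩ := excess_split φ V V X₀ (t * n) n
  set K : ℝ := C * t ^ 2 * ((idxBall X₀ (t * n)).ncard : ℝ) / ((idxBall X₀ n).ncard : ℝ) with hK
  have hK0 : 0 ≤ K := by rw [hK]; positivity
  have h3 : idxEnergy (V - M) (idxBall X₀ (t * n)) ≤ K * idxEnergy V (idxBall X₀ n) := by
    rw [hK, div_mul_eq_mul_div, le_div_iff₀ hN]
    calc idxEnergy (V - M) (idxBall X₀ (t * n)) * ((idxBall X₀ n).ncard : ℝ)
        ≤ C * t ^ 2 * idxEnergy V (idxBall X₀ n) * ((idxBall X₀ (t * n)).ncard : ℝ) := hdec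
      _ = C * t ^ 2 * ((idxBall X₀ (t * n)).ncard : ℝ) * idxEnergy V (idxBall X₀ n) := by ring
  have hM : idxEnergy M (idxBall X₀ (t * n)) ≤ (2 + 2 * K) * idxEnergy V (idxBall X₀ n) := by
    have e : M = V - (V - M) := by abel
    have h7 : idxEnergy M (idxBall X₀ (t * n)) ≤ 2 * idxEnergy V (idxBall X₀ (t * n)) + 2 * idxEnergy (V - M) (idxBall X₀ (t * n)) := by
      rw [← coe_idxBallF]
      conv_lhs => rw [e]
      exact idxEnergy_sub_le _ _ _
    nlinarith
  have hCK : 0 ≤ C * (2 + 2 * K) := by positivity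
  calc m ^ 2 * ((idxBall X₀ (t * n)).ncard : ℝ) ≤ C * idxEnergy M (idxBall X₀ (t * n)) := hm
    _ ≤ C * ((2 + 2 * K) * idxEnergy V (idxBall X₀ n)) := mul_le_mul_of_nonneg_left hM hC
    _ = C * (2 + 2 * K) * idxEnergy V (idxBall X₀ n) := by ring
    _ ≤ C * (2 + 2 * K) * (2 * idxEnergy φ (idxBall X₀ n) + 2 * W) := mul_le_mul_of_nonneg_left (by linarith) hCK

end Decay

/-! ### XJ.3  (E4) the excess after re-charting -/

section Rechart

variable {S : Set E3} {Ψ : E3 → E3} {a b a' b' : E3} {w w' : ℤ → E3} {c c' : ℝ}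

/-- ★ **(E4) THE EXCESS OF THE NEXT ITERATE**: for the re-charted registration `Ψ' = transReg Ψ a b w a' b' w'` and any field `M` such that `lsite' − lsite − M` is
`L`-index-Lipschitz (for (RC)'s chart `L = C_R m² + ε m`), `E(pullDisp S Ψ' a' b' w')(Q) ≤ 2·E(pullDisp S Ψ a b w − M)(Q) + 54·L²·#Q`. [this file, g59] -/
theorem idxEnergy_pullDisp_transReg_le (hbij : BijOn Ψ S (Layered a b w)) (hc : 0 < c) (hcr : IsLayeredCrystal c a b w) (hc' : 0 < c')
    (hcr' : IsLayeredCrystal c' a' b' w') {M : Cell 2 → ℤ → E3} {L : ℝ}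
    (hAM : ∀ X Y : Cell 2 × ℤ, ‖(lsite a' b' w' Y.1 Y.2 - lsite a b w Y.1 Y.2 - M Y.1 Y.2) -
      (lsite a' b' w' X.1 X.2 - lsite a b w X.1 X.2 - M X.1 X.2)‖ ≤ L * dist X Y) (Q : Finset (Cell 2 × ℤ)) :
    idxEnergy (pullDisp S (transReg Ψ a b w a' b' w') a' b' w') ↑Q ≤ 2 * idxEnergy (pullDisp S Ψ a b w - M) ↑Q + 54 * L ^ 2 * Q.card := by
  set A : Cell 2 → ℤ → E3 := fun γ k => lsite a' b' w' γ k - lsite a b w γ k - M γ k with hA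
  have e : pullDisp S (transReg Ψ a b w a' b' w') a' b' w' = (pullDisp S Ψ a b w - M) + -A := by
    rw [pullDisp_transReg hbij hc hcr hc' hcr']
    funext γ k
    simp only [Pi.add_apply, Pi.sub_apply, Pi.neg_apply, hA]
    rw [show pullDisp S Ψ a b w γ k = atomOf S Ψ a b w (γ, k) - lsite a b w γ k from pullDisp_eq_atomOf_sub S Ψ a b w (γ, k)]
    abel
  rw [e]
  refine (idxEnergy_add_le _ _ Q).trans ?_
  rw [idxEnergy_neg]
  have h := idxEnergy_le_of_lipschitz (A := A) (L := L) (fun X Y => by simpa only [hA] using hAM X Y) Q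
  linarith

end Rechart

end Summit.AtomisticToContinuum.Crystallization.Theorems.ChartedZeroExcessLayeredLatticeLiouville

end
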